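import Summits.AnomalousDissipation.AnomalousDissipation.Theorems.BaireTransferDenseLoudDesignerForcesErgodicPeriodicOrbitA
import Literature.Analysis.FluidPDE.TorusClassicalLerayHopfProofs
import Mathlib.Topology.Instances.AddCircle.Defs

/-!
# The NS phase carried by a time-periodic classical solution (line `ergodic-budget-selection-closing`,
# crux `BaireTransfer.DenseLoudDesignerForces`, stmt-AnomalousDissipation-1143) — part B of the periodic-orbit entry

Sorry-free (fourth lead c3-0, 2026-08-16).  For a classical solution `(u, p)` of NS_ν(F) on `ℝ × T³` (`ν ≥ 0`, steady force, mean-zero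
slices) which is time-periodic with MINIMAL period `τ₀ > 0`, the state curve `t ↦ stateOf (u t)` descends to a continuous INJECTIVE map of
the circle `ℝ/τ₀ℤ` into `H` (injectivity: equal states force, by forward determinism, a period in `[0, τ₀)`, hence `0`), i.e. a
homeomorphism onto the orbit `K = {stateOf (u t)}`; transporting the rotation of the circle gives a semiflow `φ` on `K` with
`φ_s (stateOf (u t)) = stateOf (u (t + s))` (`s ≥ 0`), and `(K, φ)` is an NS phase (`exists_isNSPhase_of_periodic`): compact, forward
invariant, jointly continuous, finite and continuous enstrophy (the enstrophy on `K` is `‖∇u(t)‖₂²` read through the inverse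
homeomorphism), classical trajectories (time translates of `(u, p)`).  This is the "NS phase of a periodic orbit" used by Entry P.

References: Foias–Manley–Rosa–Temam 2001 Ch. IV §2 (invariant measures carried by periodic orbits); Robinson–Rodrigo–Sadowski 2016 §6.3.
-/

set_option linter.dupNamespace false

noncomputable section

open scoped BigOperators Topology ENNReal InnerProductSpace
open Filter Set Function MeasureTheory

namespace Summit.AnomalousDissipation.AnomalousDissipation.Theorems.DenseLoudDesignerForces.Ergodic

open Literature.Analysis.FunctionSpaces Literature.Analysis.FunctionSpaces.Torus
open Literature.Analysis.FluidPDE Literature.Analysis.FluidPDE.Torus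
open Summit.AnomalousDissipation.AnomalousDissipation.Theses.BaireTransfer
open Summit.AnomalousDissipation.AnomalousDissipation.Theorems.DenseLoudDesignerForces.Negative

section PeriodicPhase

variable {ν : ℝ} {F : (UnitAddTorus (Fin 3)) → (EuclideanSpace ℝ (Fin 3))}
  {u : ℝ → (UnitAddTorus (Fin 3)) → (EuclideanSpace ℝ (Fin 3))} {p : ℝ → (UnitAddTorus (Fin 3)) → ℝ}

/-- **A period on a half-line is a period** for a globally periodic function: if `u (t + r) = u t` for all `t ≥ t₀` and `u` has a period
`τ₀ > 0`, then `r` is a period of `u`. [folklore] -/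
theorem periodic_of_eq_on_halfline {τ₀ : ℝ} (hτ₀ : 0 < τ₀) (hper : Periodic u τ₀) {r t₀ : ℝ} (h : ∀ t, t₀ ≤ t → u (t + r) = u t) :
    Periodic u r := by
  intro t
  -- push `t` above `t₀` by a multiple of the period
  obtain ⟨n, hn⟩ : ∃ n : ℕ, t₀ ≤ t + n * τ₀ := by
    obtain ⟨n, hn⟩ := exists_nat_gt ((t₀ - t) / τ₀)
    refine ⟨n, ?_⟩
    have : (t₀ - t) / τ₀ * τ₀ = t₀ - t := div_mul_cancel₀ _ hτ₀.ne'
    nlinarith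
  have hn' : ∀ s : ℝ, u (s + n * τ₀) = u s := fun s => hper.nat_mul n s
  calc u (t + r) = u (t + r + n * τ₀) := (hn' (t + r)).symm
    _ = u (t + n * τ₀ + r) := by ring_nf
    _ = u (t + n * τ₀) := h _ hn
    _ = u t := hn' t

/-- **Injectivity of the state curve modulo the minimal period.**  If `τ₀ > 0` is a MINIMAL period of the classical solution `u` (steady
force, mean-zero slices, `ν ≥ 0`) and the states at `t₁`, `t₂` agree, then `t₁ − t₂ ∈ τ₀ℤ`. [folklore] -/
theorem sub_mem_zmultiples_of_stateOf_eq (hν : 0 ≤ ν) (hsol : IsClassicalNSSolutionOn univ ν (fun _ => F) u p)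
    (hmean : ∀ t, HasZeroMean (u t)) {τ₀ : ℝ} (hτ₀ : 0 < τ₀) (hper : Periodic u τ₀)
    (hmin : ∀ T', 0 < T' → T' < τ₀ → ¬ Periodic u T') {t₁ t₂ : ℝ} (h : stateOf (u t₁) = stateOf (u t₂)) :
    t₁ - t₂ ∈ AddSubgroup.zmultiples τ₀ := by
  -- reduce the difference modulo `τ₀` into `[0, τ₀)`
  set r : ℝ := toIcoMod hτ₀ 0 (t₁ - t₂) with hr
  have hrmem : r ∈ Ico (0 : ℝ) (0 + τ₀) := toIcoMod_mem_Ico hτ₀ 0 _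
  obtain ⟨n, hn⟩ : ∃ n : ℤ, t₁ - t₂ - r = n • τ₀ := by
    refine ⟨toIcoDiv hτ₀ 0 (t₁ - t₂), ?_⟩
    rw [hr, toIcoMod]
    ring
  -- `r` is a period of `u` on the half-line `t ≥ t₂`, hence a period
  have hhalf : ∀ t, t₂ ≤ t → u (t + r) = u t := by
    intro t ht
    have hs : 0 ≤ t - t₂ := sub_nonneg.2 ht
    have key := slice_eq_of_stateOf_eq hν hsol hmean h hs
    -- `u (t₁ + (t - t₂)) = u (t₂ + (t - t₂)) = u t`, and `t₁ + (t - t₂) = t + r + n • τ₀`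
    have e1 : t₂ + (t - t₂) = t := by ring
    have e2 : t₁ + (t - t₂) = t + r + n • τ₀ := by rw [zsmul_eq_mul] at hn ⊢; linarith
    rw [e1, e2] at key
    rw [← key]
    exact (hper.zsmul n (t + r)).symm
  have hrper : Periodic u r := periodic_of_eq_on_halfline hτ₀ hper hhalf
  -- minimality forces `r = 0`
  have hr0 : r = 0 := by
    by_contra hne
    have hrpos : 0 < r := lt_of_le_of_ne hrmem.1 (Ne.symm hne)
    exact hmin r hrpos (by simpa using hrmem.2) hrper
  rw [hr0, sub_zero] at hn
  exact hn ▸ AddSubgroup.zsmul_mem_zmultiples τ₀ n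

/-- **The NS phase of a periodic orbit.**  For a classical solution `(u, p)` of NS_ν(F) on `ℝ × T³` (`ν ≥ 0`, steady force `F`, mean-zero
slices) with minimal period `τ₀ > 0`, the orbit `K = {stateOf (u t) : t ∈ ℝ}` carries a semiflow `φ` with
`φ_s (stateOf (u t)) = stateOf (u (t + s))` for `s ≥ 0`, and `(K, φ)` is an NS phase. [folklore] -/
theorem exists_isNSPhase_of_periodic (hν : 0 ≤ ν) (hsol : IsClassicalNSSolutionOn univ ν (fun _ => F) u p)
    (hmean : ∀ t, HasZeroMean (u t)) {τ₀ : ℝ} (hτ₀ : 0 < τ₀) (hper : Periodic u τ₀)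
    (hmin : ∀ T', 0 < T' → T' < τ₀ → ¬ Periodic u T') :
    ∃ φ : ℝ → Hsp → Hsp, IsNSPhase ν F (range fun t : ℝ => stateOf (u t)) φ ∧
      ∀ t s : ℝ, 0 ≤ s → φ s (stateOf (u t)) = stateOf (u (t + s)) := by
  classical
  haveI : Fact (0 < τ₀) := ⟨hτ₀⟩
  have hs := isSmooth_slice_of_univ hsol
  have hd : ∀ t, IsDivFree (u t) := fun t => hsol.divFree t (mem_univ t)
  -- the state curve and its descent to the circle
  set st : ℝ → Hsp := fun t => stateOf (u t) with hst
  have hstc : Continuous st := continuous_stateOf_slice hsol hmean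
  have hstper : Periodic st τ₀ := stateOf_slice_periodic hper
  set stc : AddCircle τ₀ → Hsp := hstper.lift with hstc_def
  have hstc_coe : ∀ t : ℝ, stc (t : AddCircle τ₀) = st t := fun t => hstper.lift_coe t
  have hstc_cont : Continuous stc := by
    show Continuous fun x : AddCircle τ₀ => Quotient.liftOn' x st _
    exact hstc.quotient_liftOn' _
  have hstc_inj : Injective stc := by
    intro a b hab
    induction a using QuotientAddGroup.induction_on with
    | H a =>
      induction b using QuotientAddGroup.induction_on with
      | H b =>
        rw [hstc_coe, hstc_coe] at hab
        exact (QuotientAddGroup.eq_iff_sub_mem.2 (sub_mem_zmultiples_of_stateOf_eq hν hsol hmean hτ₀ hper hmin hab))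
  have hrange : range st = range stc := by
    ext y
    constructor
    · rintro ⟨t, rfl⟩; exact ⟨t, hstc_coe t⟩
    · rintro ⟨a, rfl⟩
      induction a using QuotientAddGroup.induction_on with
      | H t => exact ⟨t, (hstc_coe t).symm⟩
  -- the homeomorphism of the circle onto the orbit
  have hemb : Topology.IsClosedEmbedding stc := hstc_cont.isClosedEmbedding hstc_inj
  set e : AddCircle τ₀ ≃ₜ range stc := hemb.isEmbedding.toHomeomorph with he
  have he_symm : ∀ t : ℝ, e.symm ⟨st t, hrange ▸ mem_range_self t⟩ = (t : AddCircle τ₀) := by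
    intro t
    have h1 : (⟨st t, hrange ▸ mem_range_self t⟩ : range stc) = ⟨stc t, mem_range_self _⟩ := by
      apply Subtype.ext; exact (hstc_coe t).symm
    rw [h1]
    exact hemb.isEmbedding.toHomeomorph_symm_apply _
  -- the angle of a state (junk `0` off the orbit) and the semiflow
  set σ : Hsp → AddCircle τ₀ := fun y => if h : y ∈ range stc then e.symm ⟨y, h⟩ else 0 with hσ
  have hσ_st : ∀ t : ℝ, σ (st t) = (t : AddCircle τ₀) := by
    intro t
    have hmem : st t ∈ range stc := hrange ▸ mem_range_self t
    simp only [hσ, dif_pos hmem]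
    exact he_symm t
  have hσ_cont : ContinuousOn σ (range st) := by
    rw [hrange, continuousOn_iff_continuous_restrict]
    have : (range stc).restrict σ = fun y => e.symm y := by
      funext y
      simp only [restrict_apply, hσ, dif_pos y.2]
    rw [this]
    exact e.symm.continuous
  set φ : ℝ → Hsp → Hsp := fun s y => stc (σ y + ((max s 0 : ℝ) : AddCircle τ₀)) with hφ
  have hφ_st : ∀ t s : ℝ, 0 ≤ s → φ s (st t) = st (t + s) := by
    intro t s hs0
    simp only [hφ, hσ_st, max_eq_left hs0]
    rw [← QuotientAddGroup.mk_add, hstc_coe]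
  have hφ_st' : ∀ t s : ℝ, φ s (st t) = st (t + max s 0) := by
    intro t s
    simp only [hφ, hσ_st]
    rw [← QuotientAddGroup.mk_add, hstc_coe]
  refine ⟨φ, ?_, hφ_st⟩
  -- the NS phase axioms
  refine
    { isCompact := ?_
      mapsTo := ?_
      map_zero := ?_
      map_add := ?_
      continuousOn := ?_
      enstrophy_finite := ?_
      enstrophy_continuousOn := ?_
      trajectory := ?_ }
  · rw [hrange]; exact isCompact_range hstc_cont
  · rintro t ht _ ⟨t', rfl⟩
    exact ⟨t' + t, (hφ_st t' t ht).symm⟩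
  · rintro _ ⟨t, rfl⟩
    rw [hφ_st t 0 le_rfl, add_zero]
  · rintro s t hs0 ht0 _ ⟨t', rfl⟩
    rw [hφ_st t' (s + t) (add_nonneg hs0 ht0), hφ_st t' t ht0, hφ_st (t' + t) s hs0]
    ring_nf
  · -- joint continuity on `[0,∞) × K` (indeed on `ℝ × K`): `φ = stc ∘ (σ ∘ snd + coe ∘ max(·,0) ∘ fst)`
    have h1 : ContinuousOn (fun q : ℝ × Hsp => σ q.2) (Ici 0 ×ˢ range st) :=
      hσ_cont.comp continuous_snd.continuousOn fun q hq => hq.2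
    have h2 : Continuous fun q : ℝ × Hsp => ((max q.1 0 : ℝ) : AddCircle τ₀) := by fun_prop
    exact hstc_cont.comp_continuousOn (h1.add h2.continuousOn)
  · rintro _ ⟨t, rfl⟩
    rw [show eGradNormSq (rep (st t)) = eGradNormSq (u t) from
      Literature.Analysis.FluidPDE.eGradNormSq_congr_ae (rep_stateOf (hs t) (hd t) (hmean t))]
    exact (eGradNormSq_lt_top (hs t)).ne
  · -- the enstrophy on `K` is `‖∇u(t)‖₂²` read through the inverse homeomorphism
    have hg : Continuous fun t : ℝ => gradNormSq (u t) :=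
      continuousOn_univ.1 (hsol.smooth_velocity.continuousOn_gradNormSq convex_univ uniqueDiffOn_univ)
    have hgper : Periodic (fun t : ℝ => gradNormSq (u t)) τ₀ := fun t => by simp only [hper t]
    set gc : AddCircle τ₀ → ℝ := hgper.lift with hgc
    have hgc_cont : Continuous gc := by
      show Continuous fun x : AddCircle τ₀ => Quotient.liftOn' x (fun t : ℝ => gradNormSq (u t)) _
      exact hg.quotient_liftOn' _
    have hkey : ∀ y ∈ range st, enstrophyObs y = gc (σ y) := by
      rintro _ ⟨t, rfl⟩
      rw [hσ_st, show gc (t : AddCircle τ₀) = gradNormSq (u t) from hgper.lift_coe t]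
      exact enstrophyObs_stateOf (hs t) (hd t) (hmean t)
    exact (hgc_cont.comp_continuousOn hσ_cont).congr hkey
  · rintro _ ⟨t, rfl⟩
    have h₁ := hsol.comp_add_const t
    rw [preimage_univ] at h₁
    refine ⟨fun s => u (s + t), fun s => p (s + t), h₁.mono (subset_univ _) (uniqueDiffOn_Ici 0), fun s hs0 => ?_⟩
    rw [hφ_st t s hs0, add_comm t s]
    exact rep_stateOf (hs _) (hd _) (hmean _)

end PeriodicPhase


section EntryP

variable {ν : ℝ}
  {u : ℝ → (UnitAddTorus (Fin 3)) → (EuclideanSpace ℝ (Fin 3))} {p : ℝ → (UnitAddTorus (Fin 3)) → ℝ}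

/-- The forward orbit of the state curve of a `τ₀`-periodic solution is the whole orbit `K`. [folklore] -/
theorem image_Ici_stateOf_eq_range {τ₀ : ℝ} (hτ₀ : 0 < τ₀) (hper : Periodic u τ₀) :
    (fun t : ℝ => stateOf (u t)) '' Ici 0 = range fun t : ℝ => stateOf (u t) := by
  refine (image_subset_range _ _).antisymm ?_
  rintro _ ⟨t, rfl⟩
  obtain ⟨n, hn⟩ : ∃ n : ℕ, 0 ≤ t + n * τ₀ := by
    obtain ⟨n, hn⟩ := exists_nat_gt (-t / τ₀)
    refine ⟨n, ?_⟩
    have : -t / τ₀ * τ₀ = -t := div_mul_cancel₀ _ hτ₀.ne'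
    nlinarith
  exact ⟨t + n * τ₀, hn, by simp only [hper.nat_mul n t]⟩

/-- **Entry P of the line `ergodic-budget-selection-closing`: a LOUD HYPERBOLIC PERIODIC ORBIT lies in the residual set.**  Let `(u, p)` be a
classical solution of NS_ν(f_c) on `ℝ × T³` with mean-zero slices and minimal period `τ₀ > 0`, at a level `j` with `0 < ν < 1/(j+1)`, LOUD
along its trajectory (`T⁻¹∫₀ᵀ∫‖u‖² ≤ E` for all large `T`, `T⁻¹∫₀ᵀ ν‖∇u‖₂² ≥ ε` for arbitrarily large `T` — for a periodic orbit these are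
the period means) and HYPERBOLIC at every point of the orbit in the classical form of `IsHyperbolicMeasure` (hypothesis `hH t`: along every
classical solution issued from the state of `u t` — necessarily `u (t + ·)` — every sub-exponentially growing linearised solution decays
exponentially after subtracting a multiple of the flow direction).  Then `c` belongs to the set of Stub 1′ at level `j`: the NS phase is the
orbit `K = {stateOf (u t)}` with its rotation semiflow (`exists_isNSPhase_of_periodic`), the loud trajectory is `x = stateOf (u 0)`, whose
orbit closure is `K`, and every invariant measure on `K` is carried by points of the orbit, where `hH` applies.  With Entry S this shows
`{c : f_c carries a loud hyperbolic steady or periodic classical orbit at level j} ⊆` (Stub 1′ set at level `j`): the residual is implied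
by the crux restricted to hyperbolic witnesses. [folklore] -/
theorem entry_periodicOrbit {S : Finset (Fin 3 → ℤ)} {c : ↥S → (EuclideanSpace ℂ (Fin 3))} {j : ℕ} {ν : ℝ}
    (hν : 0 < ν) (hνj : ν < 1 / ((j : ℝ) + 1))
    {u : ℝ → (UnitAddTorus (Fin 3)) → (EuclideanSpace ℝ (Fin 3))} {p : ℝ → (UnitAddTorus (Fin 3)) → ℝ}
    (hsol : IsClassicalNSSolutionOn univ ν (fun _ => force S c) u p) (hmean : ∀ t, HasZeroMean (u t))
    {τ₀ : ℝ} (hτ₀ : 0 < τ₀) (hper : Periodic u τ₀) (hmin : ∀ T', 0 < T' → T' < τ₀ → ¬ Periodic u T')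
    {E ε : ℝ} (hE : ∀ᶠ T in atTop, T⁻¹ * ∫ s in (0 : ℝ)..T, (∫ y, ‖u s y‖ ^ 2) ≤ E)
    (hε : ∃ᶠ T in atTop, ε ≤ T⁻¹ * ∫ s in (0 : ℝ)..T, ν * gradNormSq (u s))
    (hH : ∀ (t : ℝ) (u' : ℝ → (UnitAddTorus (Fin 3)) → (EuclideanSpace ℝ (Fin 3))) (p' : ℝ → (UnitAddTorus (Fin 3)) → ℝ),
      IsClassicalNSSolutionOn (Ici 0) ν (fun _ => force S c) u' p' → (∀ s : ℝ, 0 ≤ s → u (t + s) =ᵐ[volume] u' s) →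
      ∀ (w : ℝ → (UnitAddTorus (Fin 3)) → (EuclideanSpace ℝ (Fin 3))) (q : ℝ → (UnitAddTorus (Fin 3)) → ℝ),
        IsLinearizedNSSolutionOn (Ici 0) ν u' w q → SubExpGrowth w →
        ∃ a : ℝ, ∀ (w' : ℝ → (UnitAddTorus (Fin 3)) → (EuclideanSpace ℝ (Fin 3))) (q' : ℝ → (UnitAddTorus (Fin 3)) → ℝ),
          IsLinearizedNSSolutionOn (Ici 0) ν u' w' q' → w' 0 = w 0 - a • Torus.timeDerivWithin (Ici 0) u' 0 → ExpDecay w') :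
    ∃ ν' : ℝ, 0 < ν' ∧ ν' < 1 / ((j : ℝ) + 1) ∧
      ∃ (K : Set Hsp) (φ : ℝ → Hsp → Hsp), IsNSPhase ν' (force S c) K φ ∧
        ∃ x ∈ K, (∀ᶠ T in atTop, energyAvg φ x T ≤ E) ∧ (∃ᶠ T in atTop, ε ≤ dissipAvg ν' φ x T) ∧
          ∀ μ : Measure Hsp, IsInvariantMeasure (closure ((fun t : ℝ => φ t x) '' Ici 0)) φ μ →
            ensembleEnergy μ ≤ E → ε ≤ ensembleDissipation ν' μ → IsHyperbolicMeasure ν' (force S c) φ μ := by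
  have hs := isSmooth_slice_of_univ hsol
  have hd : ∀ t, IsDivFree (u t) := fun t => hsol.divFree t (mem_univ t)
  obtain ⟨φ, hK, hφ⟩ := exists_isNSPhase_of_periodic hν.le hsol hmean hτ₀ hper hmin
  set st : ℝ → Hsp := fun t => stateOf (u t) with hst
  have hx : st 0 ∈ range st := mem_range_self 0
  -- the forward orbit of `st 0` under `φ` is the state curve on `[0, ∞)`, whose closure is the whole orbit
  have horbit : (fun t : ℝ => φ t (st 0)) '' Ici 0 = st '' Ici 0 := by
    refine image_congr fun t ht => ?_
    show φ t (stateOf (u 0)) = stateOf (u t)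
    rw [hφ 0 t ht, zero_add]
  have hclos : closure ((fun t : ℝ => φ t (st 0)) '' Ici 0) = range st := by
    rw [horbit, hst, image_Ici_stateOf_eq_range hτ₀ hper]
    exact hK.isCompact.isClosed.closure_eq
  refine ⟨ν, hν, hνj, range st, φ, hK, st 0, hx, ?_, ?_, fun μ hμ _ _ => ?_⟩
  · -- energy budget along the trajectory
    filter_upwards [hE, eventually_gt_atTop (0 : ℝ)] with T hT hT0
    have heq : energyAvg φ (st 0) T = T⁻¹ * ∫ s in (0 : ℝ)..T, (∫ y, ‖u s y‖ ^ 2) := by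
      unfold energyAvg
      congr 1
      refine intervalIntegral.integral_congr fun s hs0 => ?_
      rw [uIcc_of_le hT0.le] at hs0
      show ‖φ s (stateOf (u 0))‖ ^ 2 = ∫ y, ‖u s y‖ ^ 2
      rw [hφ 0 s hs0.1, zero_add, norm_stateOf_sq (hs s) (hd s) (hmean s)]
    rw [heq]
    exact hT
  · -- dissipation budget along the trajectory
    refine (hε.and_eventually (eventually_gt_atTop (0 : ℝ))).mono fun T hT => ?_
    obtain ⟨hT, hT0⟩ := hT
    have heq : dissipAvg ν φ (st 0) T = T⁻¹ * ∫ s in (0 : ℝ)..T, ν * gradNormSq (u s) := by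
      unfold dissipAvg
      congr 1
      refine intervalIntegral.integral_congr fun s hs0 => ?_
      rw [uIcc_of_le hT0.le] at hs0
      show ν * enstrophyObs (φ s (stateOf (u 0))) = ν * gradNormSq (u s)
      rw [hφ 0 s hs0.1, zero_add, enstrophyObs_stateOf (hs s) (hd s) (hmean s)]
    rw [heq]
    exact hT
  · -- every invariant measure on the orbit closure is carried by points of the orbit, where `hH` applies
    rw [hclos] at hμ
    filter_upwards [IsInvariantMeasure.ae_mem hμ] with x hxK
    obtain ⟨t, rfl⟩ := hxK
    intro u' p' hu' hrep w q hw hsub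
    refine hH t u' p' hu' (fun s hs0 => ?_) w q hw hsub
    have h1 : rep (φ s (stateOf (u t))) =ᵐ[volume] u' s := hrep s hs0
    rw [hφ t s hs0] at h1
    exact (rep_stateOf (hs _) (hd _) (hmean _)).symm.trans h1

end EntryP

end Summit.AnomalousDissipation.AnomalousDissipation.Theorems.DenseLoudDesignerForces.Ergodic

end
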